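import Summits.HodgeConjecture.HodgeConjecture.Theorems.R90S1BposRamGaussSquarePrep     -- (G2)-PREP FILE A (this seat): helpers, inversion bridge, the Fubini swap
import HarnessLib

/-!
# R90 · S1 ∕ U4Keys leaf (U4f-χ₁-ram-one-pos), BRANCH B AT A TAME RAMIFIED PLACE — brick (B-10)(6a-G) (G2)-PREP, FILE B: THE GAUSS-SUM SQUARE MODULO LETTERS
# `(∫_C E(c)Ē(1+uc) dν)² = χ₁(−1)·ν(𝔪⁺)·ν(𝒪⁺)` and the (β) target shape `Φ²·X = q⁻¹·ν(𝒪⁺)²` modulo the additivity ∕ inner-value ∕ ball-ratio letters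
# [Keys1984 §4–§5, §7 Thm (2) (d); Rogawski1990 §12.2 (2); WeilBNT1967 Ch. II §5; IrelandRosen1990 Ch. 8 §2 Prop. 8.2.2]

Cell `pub/hodgecm-mathlib` (D-0151), SLAB R90-TF, section S1, crux H413 = `stmt-HodgeConjecture-24833` (lane `--supports … --as helper`), route of record `HCCMUnconditional`; prover seat
`hodgecm-mathlib-R90-C10-p07` (g2); dealer deal 02:31:43Z ∕ R-S1-29 (β).  Continues FILE A `R90S1BposRamGaussSquarePrep` (frame, sets `C, 𝔪⁺, 𝒪⁺, T`, the `dite`s `E, Ē`, the opaque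
skew parameter `u` with `|u_w| < 1`, the letters `hB hfixP hFε hadd hI₁ hI₀` — all spelled there); PART-FREE (imports only FILE A, hence the ★ fixed-units tool).  THEOREMS ONLY (no `def` ∕
`instance` ∕ notation ∕ named-fact hypothesis ∕ `sorry`).  NOT THE PAYER of :182.
* §3 THE CHARACTER MASSES `∫_{C∩T} E = χ₁(−1)·ν(𝔪⁺)` (`hfixP`: on `T = −1 + 𝔪⁺` the integrand is `χ₁(−1)`; Haar translation) and `∫_{C∖T} E = −χ₁(−1)·ν(𝔪⁺)` (★ orthogonality, `hFε`).
* §4 **`(∫_C E(c)Ē(1+uc) dν)² = χ₁(−1)·ν(𝔪⁺)·(ν(𝔪⁺) + ν(C))`** (FILE A §2 swap, then the outer integral split along `T` with the inner-value letters `hI₁ = −ν(𝔪⁺)`, `hI₀ = ν(C)`).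
* §5 THE (β) TARGET SHAPE **`Φ² · X = q⁻¹ · ν(𝒪⁺)²`** modulo `hΦ : Φ = χ₁(δ′)⁻¹·∫_C Ē(c)Ē(1+u c⁻¹) dν` (= ★-to-be PART 2 §1 `setIntegral_sphere_diteInv_sub_eq` at `ν := μ⁻.map M⁻¹`,
  `u := −aδ⁻¹`, `δ′ := −δ`), `hX : X = χ₁(σΠ̂·Π̂)` (ONE CURRENCY; FILE A `chi_skewUnit_sq`: `χ₁(δ′)² = χ₁(−1)·X`) and the ball ratio `hball : ν(𝒪⁺) = q·ν(𝔪⁺)`; the sign `χ₁(−1)` CANCELS.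
  R90-C10-p04 (g3)'s (β) `R90S1BposRamGaussSphereValues` discharges the letters from ★ PART 1∕2∕3 and rewrites `ν(𝒪⁺) = μ⁻{|y_w| ≤ 1}`.
HONEST LABEL.  HC_CM is proved only modulo the 7 printed citations (2 remaining named inputs: hLiu418 = `stmt-HodgeConjecture-24832`, h413 = `stmt-HodgeConjecture-24833`) until rung 0
closes; count-neutral — this file does NOT pay :182 (nor :155, nor A2′); no printed citation is discharged; REL ≠ ★ ≠ BUILT.

## References
* [Keys1984] D. Keys, *Principal series representations of special unitary groups over local fields*, Compositio Math. 51 (1984), §4–§5, §7 Theorem (2) (d) p. 126.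
* [Rogawski1990] J. D. Rogawski, *Automorphic Representations of Unitary Groups in Three Variables*, Ann. of Math. Stud. 123 (1990), §12.2 (2) p. 173.
* [WeilBNT1967] A. Weil, *Basic Number Theory* (1967), Ch. I §2, Ch. II §5.
* [IrelandRosen1990] K. Ireland, M. Rosen, *A Classical Introduction to Modern Number Theory*, 2nd ed., GTM 84 (1990), Ch. 8 §2 Prop. 8.2.2 (`g² = χ(−1)p`).
-/

set_option autoImplicit false
-- the mandated namespace has the single-problem summit's repeated segment (`HodgeConjecture.HodgeConjecture`)
set_option linter.dupNamespace false

noncomputable section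
open NumberField IsDedekindDomain MeasureTheory Measure Topology Set
open scoped NNReal ENNReal
open Literature.NumberTheory Literature.NumberTheory.Automorphic Literature.NumberTheory.Automorphic.UnitaryGroup

namespace Summit.HodgeConjecture.HodgeConjecture.R90.S1.BposRamGaussSquareModLetters

open Summit.HodgeConjecture.HodgeConjecture.Cruxes.H413
open Summit.HodgeConjecture.HodgeConjecture.Cruxes.H413.K2E3BranchBSkewLineIntegrals
open Summit.HodgeConjecture.HodgeConjecture.Cruxes.H413.K2E3BranchBSkewLineCharacterIntegral
open Summit.HodgeConjecture.HodgeConjecture.Cruxes.H413.K2E3BranchBSkewUnitSign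
open Summit.HodgeConjecture.HodgeConjecture.R90.S1.BposRamFixedUnitsHaar
open Summit.HodgeConjecture.HodgeConjecture.R90.S1.BposRamGaussSquarePrep

variable (L : Type) [Field L] [NumberField L] [IsCMField L] (v : HeightOneSpectrum (𝓞 ↥(maximalRealSubfield L)))
  (w : PlacesOver L v) (hw : IsCMField.complexConj L • w.1 = w.1)

section Haar
variable [MeasurableSpace (LocalRing L v)] [BorelSpace (LocalRing L v)]
  (ν : Measure ↥(HeisRing.fixedPart (conjLocal L (IsCMField.complexConj L) v))) [ν.IsAddHaarMeasure] [ν.Regular]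
  (χ₁ : (LocalRing L v)ˣ →* ℂˣ) (h₁ : Continuous fun x => ((χ₁ x : ℂˣ) : ℂ)) {u : LocalRing L v} (hu : Valued.v (u w) < 1)

/-! ## §3 THE CHARACTER MASSES on `C ∩ T = −1 + 𝔪⁺` and on `C ∖ T` -/
open scoped Classical in
omit [ν.Regular] in
include hw in
/-- **`∫_{C ∩ T} E(e) dν = χ₁(−1)·ν(𝔪⁺)`**, `T = {e : |(1+e)_w| < 1}`: there `e = (−1)·(1 − d)` with `d := 1 + e ∈ 𝔪⁺`, `1 − d` a `σ`-fixed PRINCIPAL unit (`χ₁ = 1` by `hfixP`), so `E(e) = χ₁(−1)`;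
and `C ∩ T = T` is the translate `−1 + 𝔪⁺` (Haar translation invariance). [cite: WeilBNT1967, Ch. II §5] [cite: Keys1984, §7 Theorem (2) (d) p. 126] -/
theorem setIntegral_fixedUnits_inter_dite_eq
    (hfixP : ∀ u : (LocalRing L v)ˣ, (∀ w' : PlacesOver L v, Valued.v (((u : LocalRing L v) w') - 1) < 1) →
      conjLocal L (IsCMField.complexConj L) v (u : LocalRing L v) = u → χ₁ u = 1) :
    ∫ e in {c : ↥(HeisRing.fixedPart (conjLocal L (IsCMField.complexConj L) v)) | Valued.v ((c : LocalRing L v) w) = 1} ∩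
        {e : ↥(HeisRing.fixedPart (conjLocal L (IsCMField.complexConj L) v)) | Valued.v ((1 + (e : LocalRing L v)) w) < 1},
        (fun r : LocalRing L v => if h : IsUnit r then ((χ₁ h.unit : ℂˣ) : ℂ) else 0) (e : LocalRing L v) ∂ν =
      ((χ₁ (-1) : ℂˣ) : ℂ) * ((ν.real {d : ↥(HeisRing.fixedPart (conjLocal L (IsCMField.complexConj L) v)) | Valued.v ((d : LocalRing L v) w) < 1} : ℝ) : ℂ) := by
  have hfix : ∀ c : ↥(HeisRing.fixedPart (conjLocal L (IsCMField.complexConj L) v)), conjLocal L (IsCMField.complexConj L) v (c : LocalRing L v) = c :=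
    fun c => (HeisRing.mem_fixedPart_iff _ _).1 c.2
  -- `C ∩ T = T`
  have hCT : {c : ↥(HeisRing.fixedPart (conjLocal L (IsCMField.complexConj L) v)) | Valued.v ((c : LocalRing L v) w) = 1} ∩
      {e : ↥(HeisRing.fixedPart (conjLocal L (IsCMField.complexConj L) v)) | Valued.v ((1 + (e : LocalRing L v)) w) < 1} =
      {e : ↥(HeisRing.fixedPart (conjLocal L (IsCMField.complexConj L) v)) | Valued.v ((1 + (e : LocalRing L v)) w) < 1} := by
    refine Set.inter_eq_right.2 fun e (he : Valued.v ((1 + (e : LocalRing L v)) w) < 1) => ?_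
    show Valued.v ((e : LocalRing L v) w) = 1
    have h : (e : LocalRing L v) w = -1 + (1 + (e : LocalRing L v)) w := by rw [Pi.add_apply, Pi.one_apply]; ring
    rw [h, Valuation.map_add_eq_of_lt_left _ (by rw [Valuation.map_neg, map_one]; exact he), Valuation.map_neg, map_one]
  rw [hCT]
  -- translation by `1⁺`
  set one : ↥(HeisRing.fixedPart (conjLocal L (IsCMField.complexConj L) v)) := ⟨1, by rw [HeisRing.mem_fixedPart_iff, map_one]⟩ with hone
  have hpre : {e : ↥(HeisRing.fixedPart (conjLocal L (IsCMField.complexConj L) v)) | Valued.v ((1 + (e : LocalRing L v)) w) < 1} =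
      (fun e => one + e) ⁻¹' {d : ↥(HeisRing.fixedPart (conjLocal L (IsCMField.complexConj L) v)) | Valued.v ((d : LocalRing L v) w) < 1} := by
    ext e; simp only [Set.mem_setOf_eq, Set.mem_preimage, AddSubgroup.coe_add, hone]
  have key := (measurePreserving_add_left ν one).setIntegral_preimage_emb (Homeomorph.addLeft one).measurableEmbedding
    (fun d : ↥(HeisRing.fixedPart (conjLocal L (IsCMField.complexConj L) v)) => (fun r : LocalRing L v => if h : IsUnit r then ((χ₁ h.unit : ℂˣ) : ℂ) else 0) ((d : LocalRing L v) - 1))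
    {d : ↥(HeisRing.fixedPart (conjLocal L (IsCMField.complexConj L) v)) | Valued.v ((d : LocalRing L v) w) < 1}
  have hcomp : (fun e : ↥(HeisRing.fixedPart (conjLocal L (IsCMField.complexConj L) v)) => (fun r : LocalRing L v => if h : IsUnit r then ((χ₁ h.unit : ℂˣ) : ℂ) else 0) ((((one + e : ↥(HeisRing.fixedPart (conjLocal L (IsCMField.complexConj L) v)))) : LocalRing L v) - 1)) =
      fun e : ↥(HeisRing.fixedPart (conjLocal L (IsCMField.complexConj L) v)) => (fun r : LocalRing L v => if h : IsUnit r then ((χ₁ h.unit : ℂˣ) : ℂ) else 0) (e : LocalRing L v) := by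
    funext e; rw [AddSubgroup.coe_add, hone, add_sub_cancel_left]
  rw [hpre, ← hcomp, key]
  -- on `𝔪⁺` the integrand is the constant `χ₁(−1)`
  have hconst : ∀ d ∈ {d : ↥(HeisRing.fixedPart (conjLocal L (IsCMField.complexConj L) v)) | Valued.v ((d : LocalRing L v) w) < 1},
      (fun r : LocalRing L v => if h : IsUnit r then ((χ₁ h.unit : ℂˣ) : ℂ) else 0) ((d : LocalRing L v) - 1) = ((χ₁ (-1) : ℂˣ) : ℂ) := by
    intro d hd
    rw [Set.mem_setOf_eq] at hd
    have h1d : Valued.v ((1 - (d : LocalRing L v)) w) = 1 := by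
      rw [sub_eq_add_neg, Pi.add_apply, Pi.one_apply, Pi.neg_apply]
      exact Valuation.map_one_add_of_lt _ (by rw [Valuation.map_neg]; exact hd)
    have hU := isUnit_of_valued_eq_one L v w hw h1d
    have hχ : χ₁ hU.unit = 1 := by
      refine hfixP hU.unit (forall_placesOver_of_apply L v w hw (P := fun w' => Valued.v (((hU.unit : LocalRing L v) w') - 1) < 1) ?_) ?_
      · rw [IsUnit.unit_spec, Pi.sub_apply, Pi.one_apply, sub_sub_cancel_left, Valuation.map_neg]; exact hd
      · rw [IsUnit.unit_spec, map_sub, map_one, hfix d]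
    have hfac : (d : LocalRing L v) - 1 = (((-1 : (LocalRing L v)ˣ)) : LocalRing L v) * (1 - (d : LocalRing L v)) := by rw [Units.val_neg, Units.val_one]; ring
    rw [hfac, dite_chi_units_mul L v χ₁ (-1) (1 - (d : LocalRing L v))]
    beta_reduce
    rw [dif_pos hU, hχ, Units.val_one, mul_one]
  rw [setIntegral_congr_fun (measurableSet_fixedBalls L v w).1 hconst, setIntegral_const, Complex.real_smul, mul_comm]
open scoped Classical in
include hw h₁ in
/-- **`∫_{C ∖ T} E(e) dν = −χ₁(−1)·ν(𝔪⁺)`**: `∫_C E = 0` by ★ ORTHOGONALITY (the (R-b) witness `hFε`) and §3's first half. [cite: WeilBNT1967, Ch. II §5] [cite: Keys1984, §7 Theorem (2) (d) p. 126] -/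
theorem setIntegral_fixedUnits_diff_dite_eq
    (hfixP : ∀ u : (LocalRing L v)ˣ, (∀ w' : PlacesOver L v, Valued.v (((u : LocalRing L v) w') - 1) < 1) →
      conjLocal L (IsCMField.complexConj L) v (u : LocalRing L v) = u → χ₁ u = 1)
    (hFε : ∃ a₀ : (LocalRing L v)ˣ, Units.map (conjLocal L (IsCMField.complexConj L) v : LocalRing L v →* LocalRing L v) a₀ = a₀ ∧
      (∀ w' : PlacesOver L v, Valued.v ((a₀ : LocalRing L v) w') = 1) ∧ χ₁ a₀ ≠ 1) :
    ∫ e in {c : ↥(HeisRing.fixedPart (conjLocal L (IsCMField.complexConj L) v)) | Valued.v ((c : LocalRing L v) w) = 1} \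
        {e : ↥(HeisRing.fixedPart (conjLocal L (IsCMField.complexConj L) v)) | Valued.v ((1 + (e : LocalRing L v)) w) < 1},
        (fun r : LocalRing L v => if h : IsUnit r then ((χ₁ h.unit : ℂˣ) : ℂ) else 0) (e : LocalRing L v) ∂ν =
      -(((χ₁ (-1) : ℂˣ) : ℂ) * ((ν.real {d : ↥(HeisRing.fixedPart (conjLocal L (IsCMField.complexConj L) v)) | Valued.v ((d : LocalRing L v) w) < 1} : ℝ) : ℂ)) := by
  obtain ⟨a₀, ha₀σ, ha₀v, hχa₀⟩ := hFε
  have ha₀σ' : conjLocal L (IsCMField.complexConj L) v (a₀ : LocalRing L v) = a₀ := by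
    have h := congrArg (fun u : (LocalRing L v)ˣ => (u : LocalRing L v)) ha₀σ
    simpa only [Units.coe_map, MonoidHom.coe_coe] using h
  have horth := setIntegral_fixedUnits_dite_eq_zero_of_unit L v w hw ν χ₁ a₀ ha₀σ' (ha₀v w) hχa₀
  have hCm : MeasurableSet {c : ↥(HeisRing.fixedPart (conjLocal L (IsCMField.complexConj L) v)) | Valued.v ((c : LocalRing L v) w) = 1} :=
    (measurableSet_fixedUnits L v w).1
  obtain ⟨-, hCtop⟩ := measure_fixedUnits_pos_lt_top L v w hw ν
  have hint : IntegrableOn (fun e : ↥(HeisRing.fixedPart (conjLocal L (IsCMField.complexConj L) v)) =>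
      (fun r : LocalRing L v => if h : IsUnit r then ((χ₁ h.unit : ℂˣ) : ℂ) else 0) (e : LocalRing L v))
      {c : ↥(HeisRing.fixedPart (conjLocal L (IsCMField.complexConj L) v)) | Valued.v ((c : LocalRing L v) w) = 1} ν :=
    Measure.integrableOn_of_bounded hCtop.ne ((measurable_dite_isUnit L v w hw (fun x => ((χ₁ x : ℂˣ) : ℂ)) h₁).comp measurable_subtype_coe).aestronglyMeasurable
      ((ae_restrict_mem hCm).mono fun e he => norm_dite_apply_le_one L v w hw χ₁ h₁ _ he)
  have hsplit := integral_inter_add_sdiff (measurableSet_fixedBalls L v w).2.2 hint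
  rw [horth, setIntegral_fixedUnits_inter_dite_eq L v w hw ν χ₁ hfixP] at hsplit
  linear_combination hsplit

/-! ## §4 THE GAUSS-SUM SQUARE modulo the two inner-value letters -/
open scoped Classical in
include hw h₁ hu in
/-- **`(∫_C E(c)·Ē(1+uc) dν)² = χ₁(−1)·ν(𝔪⁺)·(ν(𝔪⁺) + ν(C))`** given the inner values `∫_C Ē(1 + u(1+e)c) dν(c) = −ν(𝔪⁺)` for `|1+e| = 1` (`hI₁`) and `= ν(C)` for `|1+e| < 1` (`hI₀`): §2,
then split the outer integral along `T` (§3).  (Classically `g² = ε(−1)·q` for the quadratic Gauss sum.) [cite: IrelandRosen1990, Ch. 8 §2 Prop. 8.2.2] [cite: Keys1984, §4–§5, §7 Theorem (2) (d)]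
[cite: WeilBNT1967, Ch. II §5] -/
theorem gauss_sq_eq
    (hB : ∀ u : (LocalRing L v)ˣ, (∀ w' : PlacesOver L v, Valued.v ((u : LocalRing L v) w') = 1) →
      χ₁ (u * Units.map (conjLocal L (IsCMField.complexConj L) v : LocalRing L v →* LocalRing L v) u) = 1)
    (hfixP : ∀ u : (LocalRing L v)ˣ, (∀ w' : PlacesOver L v, Valued.v (((u : LocalRing L v) w') - 1) < 1) →
      conjLocal L (IsCMField.complexConj L) v (u : LocalRing L v) = u → χ₁ u = 1)
    (hFε : ∃ a₀ : (LocalRing L v)ˣ, Units.map (conjLocal L (IsCMField.complexConj L) v : LocalRing L v →* LocalRing L v) a₀ = a₀ ∧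
      (∀ w' : PlacesOver L v, Valued.v ((a₀ : LocalRing L v) w') = 1) ∧ χ₁ a₀ ≠ 1)
    (hadd : ∀ c e : LocalRing L v, conjLocal L (IsCMField.complexConj L) v c = c → Valued.v (c w) = 1 →
      conjLocal L (IsCMField.complexConj L) v e = e → Valued.v (e w) = 1 →
      (fun r : LocalRing L v => if h : IsUnit r then (((χ₁ h.unit)⁻¹ : ℂˣ) : ℂ) else 0) (1 + u * c) *
          (fun r : LocalRing L v => if h : IsUnit r then (((χ₁ h.unit)⁻¹ : ℂˣ) : ℂ) else 0) (1 + u * (c * e)) =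
        (fun r : LocalRing L v => if h : IsUnit r then (((χ₁ h.unit)⁻¹ : ℂˣ) : ℂ) else 0) (1 + u * (1 + e) * c))
    (hI₁ : ∀ e : LocalRing L v, conjLocal L (IsCMField.complexConj L) v e = e → Valued.v (e w) = 1 → Valued.v ((1 + e) w) = 1 →
      ∫ c in {c : ↥(HeisRing.fixedPart (conjLocal L (IsCMField.complexConj L) v)) | Valued.v ((c : LocalRing L v) w) = 1},
          (fun r : LocalRing L v => if h : IsUnit r then (((χ₁ h.unit)⁻¹ : ℂˣ) : ℂ) else 0) (1 + u * (1 + e) * (c : LocalRing L v)) ∂ν =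
        -((ν.real {d : ↥(HeisRing.fixedPart (conjLocal L (IsCMField.complexConj L) v)) | Valued.v ((d : LocalRing L v) w) < 1} : ℝ) : ℂ))
    (hI₀ : ∀ e : LocalRing L v, conjLocal L (IsCMField.complexConj L) v e = e → Valued.v (e w) = 1 → Valued.v ((1 + e) w) < 1 →
      ∫ c in {c : ↥(HeisRing.fixedPart (conjLocal L (IsCMField.complexConj L) v)) | Valued.v ((c : LocalRing L v) w) = 1},
          (fun r : LocalRing L v => if h : IsUnit r then (((χ₁ h.unit)⁻¹ : ℂˣ) : ℂ) else 0) (1 + u * (1 + e) * (c : LocalRing L v)) ∂ν =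
        ((ν.real {c : ↥(HeisRing.fixedPart (conjLocal L (IsCMField.complexConj L) v)) | Valued.v ((c : LocalRing L v) w) = 1} : ℝ) : ℂ)) :
    (∫ c in {c : ↥(HeisRing.fixedPart (conjLocal L (IsCMField.complexConj L) v)) | Valued.v ((c : LocalRing L v) w) = 1},
        (fun r : LocalRing L v => if h : IsUnit r then ((χ₁ h.unit : ℂˣ) : ℂ) else 0) (c : LocalRing L v) *
          (fun r : LocalRing L v => if h : IsUnit r then (((χ₁ h.unit)⁻¹ : ℂˣ) : ℂ) else 0) (1 + u * (c : LocalRing L v)) ∂ν) ^ 2 =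
      ((χ₁ (-1) : ℂˣ) : ℂ) * ((ν.real {d : ↥(HeisRing.fixedPart (conjLocal L (IsCMField.complexConj L) v)) | Valued.v ((d : LocalRing L v) w) < 1} : ℝ) : ℂ) *
        (((ν.real {d : ↥(HeisRing.fixedPart (conjLocal L (IsCMField.complexConj L) v)) | Valued.v ((d : LocalRing L v) w) < 1} : ℝ) : ℂ) +
          ((ν.real {c : ↥(HeisRing.fixedPart (conjLocal L (IsCMField.complexConj L) v)) | Valued.v ((c : LocalRing L v) w) = 1} : ℝ) : ℂ)) := by
  haveI : SecondCountableTopology (LocalRing L v) := secondCountableTopology_localRing (E := L) v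
  haveI : SecondCountableTopology ↥(HeisRing.fixedPart (conjLocal L (IsCMField.complexConj L) v)) := TopologicalSpace.Subtype.secondCountableTopology _
  haveI := HeisRing.locallyCompactSpace_fixedPart (conjLocal L (IsCMField.complexConj L) v) (continuous_conjLocal L (IsCMField.complexConj L) v)
  set C : Set ↥(HeisRing.fixedPart (conjLocal L (IsCMField.complexConj L) v)) := {c | Valued.v ((c : LocalRing L v) w) = 1} with hCdef
  set T : Set ↥(HeisRing.fixedPart (conjLocal L (IsCMField.complexConj L) v)) := {e | Valued.v ((1 + (e : LocalRing L v)) w) < 1} with hTdef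
  set I : ↥(HeisRing.fixedPart (conjLocal L (IsCMField.complexConj L) v)) → ℂ := fun e =>
    ∫ c in C, (fun r : LocalRing L v => if h : IsUnit r then (((χ₁ h.unit)⁻¹ : ℂˣ) : ℂ) else 0) (1 + u * (1 + (e : LocalRing L v)) * (c : LocalRing L v)) ∂ν with hIdef
  have hfix : ∀ c : ↥(HeisRing.fixedPart (conjLocal L (IsCMField.complexConj L) v)), conjLocal L (IsCMField.complexConj L) v (c : LocalRing L v) = c :=
    fun c => (HeisRing.mem_fixedPart_iff _ _).1 c.2
  have hCm : MeasurableSet C := (measurableSet_fixedUnits L v w).1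
  have hTm : MeasurableSet T := (measurableSet_fixedBalls L v w).2.2
  obtain ⟨-, hCtop⟩ := measure_fixedUnits_pos_lt_top L v w hw ν
  haveI : IsFiniteMeasure (ν.restrict C) := ⟨by rw [Measure.restrict_apply_univ]; exact hCtop⟩
  rw [setIntegral_fixedUnits_gauss_sq_eq L v w hw ν χ₁ h₁ hu hB hadd]
  -- `|I(e)| ≤ ν(C)` on `C`, so `e ↦ E(e)·I(e)` is integrable on `C`
  have hIb : ∀ e ∈ C, ‖I e‖ ≤ 1 * ν.real C := fun e he => by
    rw [hIdef]
    refine norm_setIntegral_le_of_norm_le_const hCtop fun c hc => ?_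
    beta_reduce
    refine norm_diteInv_apply_le_one L v w hw χ₁ h₁ _ ?_
    rw [mul_assoc]
    refine valued_one_add_mul_apply_eq_one L v w hu ?_
    rw [Pi.mul_apply, map_mul]
    exact mul_le_one' (valued_one_add_apply_le_one L v w he) hc.le
  have hEbm : Measurable (fun r : LocalRing L v => if h : IsUnit r then (((χ₁ h.unit)⁻¹ : ℂˣ) : ℂ) else 0) :=
    measurable_dite_isUnit L v w hw (fun x => (((χ₁ x)⁻¹ : ℂˣ) : ℂ)) (continuous_chiInv L v χ₁ h₁)
  have hFm : Measurable (Function.uncurry fun (e c : ↥(HeisRing.fixedPart (conjLocal L (IsCMField.complexConj L) v))) =>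
      (fun r : LocalRing L v => if h : IsUnit r then (((χ₁ h.unit)⁻¹ : ℂˣ) : ℂ) else 0) (1 + u * (1 + (e : LocalRing L v)) * (c : LocalRing L v))) :=
    hEbm.comp (continuous_const.add ((continuous_const.mul (continuous_const.add (continuous_subtype_val.comp continuous_fst))).mul
      (continuous_subtype_val.comp continuous_snd))).measurable
  have hIm : AEStronglyMeasurable (fun e : ↥(HeisRing.fixedPart (conjLocal L (IsCMField.complexConj L) v)) => (fun r : LocalRing L v => if h : IsUnit r then ((χ₁ h.unit : ℂˣ) : ℂ) else 0) (e : LocalRing L v) * I e) ν :=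
    (((measurable_dite_isUnit L v w hw (fun x => ((χ₁ x : ℂˣ) : ℂ)) h₁).comp measurable_subtype_coe).aestronglyMeasurable).mul
      (hFm.stronglyMeasurable.integral_prod_right (ν := ν.restrict C)).aestronglyMeasurable
  have hint : IntegrableOn (fun e : ↥(HeisRing.fixedPart (conjLocal L (IsCMField.complexConj L) v)) => (fun r : LocalRing L v => if h : IsUnit r then ((χ₁ h.unit : ℂˣ) : ℂ) else 0) (e : LocalRing L v) * I e) C ν :=
    Measure.integrableOn_of_bounded hCtop.ne hIm ((ae_restrict_mem hCm).mono fun e he => by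
      rw [norm_mul]; exact mul_le_mul (norm_dite_apply_le_one L v w hw χ₁ h₁ _ he) (hIb e he) (norm_nonneg _) zero_le_one)
  rw [← integral_inter_add_sdiff hTm hint]
  -- the two pieces: `I = ν(C)` on `C ∩ T`, `I = −ν(𝔪⁺)` on `C ∖ T`
  have h0 : ∫ e in C ∩ T, (fun r : LocalRing L v => if h : IsUnit r then ((χ₁ h.unit : ℂˣ) : ℂ) else 0) (e : LocalRing L v) * I e ∂ν =
      (∫ e in C ∩ T, (fun r : LocalRing L v => if h : IsUnit r then ((χ₁ h.unit : ℂˣ) : ℂ) else 0) (e : LocalRing L v) ∂ν) * ((ν.real C : ℝ) : ℂ) := by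
    rw [← integral_mul_const]
    refine setIntegral_congr_fun (hCm.inter hTm) fun e he => ?_
    show (fun r : LocalRing L v => if h : IsUnit r then ((χ₁ h.unit : ℂˣ) : ℂ) else 0) (e : LocalRing L v) * I e = (fun r : LocalRing L v => if h : IsUnit r then ((χ₁ h.unit : ℂˣ) : ℂ) else 0) (e : LocalRing L v) * ((ν.real C : ℝ) : ℂ)
    rw [hIdef]; beta_reduce
    have h := hI₀ _ (hfix e) he.1 he.2
    beta_reduce at h
    rw [h]
  have h1 : ∫ e in C \ T, (fun r : LocalRing L v => if h : IsUnit r then ((χ₁ h.unit : ℂˣ) : ℂ) else 0) (e : LocalRing L v) * I e ∂ν =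
      (∫ e in C \ T, (fun r : LocalRing L v => if h : IsUnit r then ((χ₁ h.unit : ℂˣ) : ℂ) else 0) (e : LocalRing L v) ∂ν) * -((ν.real {d : ↥(HeisRing.fixedPart (conjLocal L (IsCMField.complexConj L) v)) | Valued.v ((d : LocalRing L v) w) < 1} : ℝ) : ℂ) := by
    rw [← integral_mul_const]
    refine setIntegral_congr_fun (hCm.diff hTm) fun e he => ?_
    have he1 : Valued.v ((1 + (e : LocalRing L v)) w) = 1 := le_antisymm (valued_one_add_apply_le_one L v w he.1) (not_lt.1 he.2)
    show (fun r : LocalRing L v => if h : IsUnit r then ((χ₁ h.unit : ℂˣ) : ℂ) else 0) (e : LocalRing L v) * I e = (fun r : LocalRing L v => if h : IsUnit r then ((χ₁ h.unit : ℂˣ) : ℂ) else 0) (e : LocalRing L v) * -((ν.real {d : ↥(HeisRing.fixedPart (conjLocal L (IsCMField.complexConj L) v)) | Valued.v ((d : LocalRing L v) w) < 1} : ℝ) : ℂ)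
    rw [hIdef]; beta_reduce
    have h := hI₁ _ (hfix e) he.1 he1
    beta_reduce at h
    rw [h]
  rw [h0, h1, setIntegral_fixedUnits_inter_dite_eq L v w hw ν χ₁ hfixP, setIntegral_fixedUnits_diff_dite_eq L v w hw ν χ₁ h₁ hfixP hFε]
  ring

/-! ## §5 THE (β) TARGET SHAPE `Φ²·X = q⁻¹·ν(𝒪⁺)²` modulo letters -/
variable (Φ X : ℂ) (δ' : (LocalRing L v)ˣ) (piU : (LocalRing L v)ˣ)
open scoped Classical in
include hw h₁ hu in
/-- **THE (β) TARGET SHAPE, MODULO LETTERS: `Φ² · X = q⁻¹ · ν(𝒪⁺)²`.**  Here `Φ = χ₁(δ′)⁻¹·∫_C Ē(c)Ē(1 + u c⁻¹) dν` (`hΦ` = ★-to-be PART 2 §1 `setIntegral_sphere_diteInv_sub_eq` at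
`ν := μ⁻.map M⁻¹`, `u := −aδ⁻¹`, `δ′ := −δ`), `X = χ₁(σΠ̂·Π̂)` (ONE CURRENCY), `hball : ν(𝒪⁺) = q·ν(𝔪⁺)` (`q = N𝔭_v`; the fixed uniformiser has module `q⁻¹`), plus §4's letters.  Proof: §1, §4,
`χ₁(δ′)² = χ₁(−1)·X` and `ν(𝒪⁺) = ν(C) + ν(𝔪⁺)` — the sign `χ₁(−1)` CANCELS.  p04 (g3) rewrites `ν(𝒪⁺) = μ⁻{|y_w| ≤ 1}` to reach (β). [cite: Keys1984, §7 Theorem (2) (d) p. 126]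
[cite: Rogawski1990, §12.2 (2) p. 173] [cite: IrelandRosen1990, Ch. 8 §2 Prop. 8.2.2] -/
theorem sphere_sq_mul_X_eq
    (hB : ∀ u : (LocalRing L v)ˣ, (∀ w' : PlacesOver L v, Valued.v ((u : LocalRing L v) w') = 1) →
      χ₁ (u * Units.map (conjLocal L (IsCMField.complexConj L) v : LocalRing L v →* LocalRing L v) u) = 1)
    (hfixP : ∀ u : (LocalRing L v)ˣ, (∀ w' : PlacesOver L v, Valued.v (((u : LocalRing L v) w') - 1) < 1) →
      conjLocal L (IsCMField.complexConj L) v (u : LocalRing L v) = u → χ₁ u = 1)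
    (hFε : ∃ a₀ : (LocalRing L v)ˣ, Units.map (conjLocal L (IsCMField.complexConj L) v : LocalRing L v →* LocalRing L v) a₀ = a₀ ∧
      (∀ w' : PlacesOver L v, Valued.v ((a₀ : LocalRing L v) w') = 1) ∧ χ₁ a₀ ≠ 1)
    (hadd : ∀ c e : LocalRing L v, conjLocal L (IsCMField.complexConj L) v c = c → Valued.v (c w) = 1 →
      conjLocal L (IsCMField.complexConj L) v e = e → Valued.v (e w) = 1 →
      (fun r : LocalRing L v => if h : IsUnit r then (((χ₁ h.unit)⁻¹ : ℂˣ) : ℂ) else 0) (1 + u * c) *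
          (fun r : LocalRing L v => if h : IsUnit r then (((χ₁ h.unit)⁻¹ : ℂˣ) : ℂ) else 0) (1 + u * (c * e)) =
        (fun r : LocalRing L v => if h : IsUnit r then (((χ₁ h.unit)⁻¹ : ℂˣ) : ℂ) else 0) (1 + u * (1 + e) * c))
    (hI₁ : ∀ e : LocalRing L v, conjLocal L (IsCMField.complexConj L) v e = e → Valued.v (e w) = 1 → Valued.v ((1 + e) w) = 1 →
      ∫ c in {c : ↥(HeisRing.fixedPart (conjLocal L (IsCMField.complexConj L) v)) | Valued.v ((c : LocalRing L v) w) = 1},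
          (fun r : LocalRing L v => if h : IsUnit r then (((χ₁ h.unit)⁻¹ : ℂˣ) : ℂ) else 0) (1 + u * (1 + e) * (c : LocalRing L v)) ∂ν =
        -((ν.real {d : ↥(HeisRing.fixedPart (conjLocal L (IsCMField.complexConj L) v)) | Valued.v ((d : LocalRing L v) w) < 1} : ℝ) : ℂ))
    (hI₀ : ∀ e : LocalRing L v, conjLocal L (IsCMField.complexConj L) v e = e → Valued.v (e w) = 1 → Valued.v ((1 + e) w) < 1 →
      ∫ c in {c : ↥(HeisRing.fixedPart (conjLocal L (IsCMField.complexConj L) v)) | Valued.v ((c : LocalRing L v) w) = 1},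
          (fun r : LocalRing L v => if h : IsUnit r then (((χ₁ h.unit)⁻¹ : ℂˣ) : ℂ) else 0) (1 + u * (1 + e) * (c : LocalRing L v)) ∂ν =
        ((ν.real {c : ↥(HeisRing.fixedPart (conjLocal L (IsCMField.complexConj L) v)) | Valued.v ((c : LocalRing L v) w) = 1} : ℝ) : ℂ))
    (hδ'σ : conjLocal L (IsCMField.complexConj L) v (δ' : LocalRing L v) = -(δ' : LocalRing L v)) (hδ'v : Valued.v ((δ' : LocalRing L v) w) = WithZero.exp (-1 : ℤ))
    (hpiU : ∀ w' : PlacesOver L v, Valued.v ((piU : LocalRing L v) w') = WithZero.exp (-1 : ℤ))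
    (hΦ : Φ = (((χ₁ δ')⁻¹ : ℂˣ) : ℂ) *
      ∫ c in {c : ↥(HeisRing.fixedPart (conjLocal L (IsCMField.complexConj L) v)) | Valued.v ((c : LocalRing L v) w) = 1},
        (fun r : LocalRing L v => if h : IsUnit r then (((χ₁ h.unit)⁻¹ : ℂˣ) : ℂ) else 0) (c : LocalRing L v) *
          (fun r : LocalRing L v => if h : IsUnit r then (((χ₁ h.unit)⁻¹ : ℂˣ) : ℂ) else 0) (1 + u * ((c : LocalRing L v))⁻¹) ∂ν)
    (hX : X = ((χ₁ (Units.map (conjLocal L (IsCMField.complexConj L) v : LocalRing L v →* LocalRing L v) piU * piU) : ℂˣ) : ℂ))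
    (hball : ν.real {d : ↥(HeisRing.fixedPart (conjLocal L (IsCMField.complexConj L) v)) | Valued.v ((d : LocalRing L v) w) ≤ 1} =
      (Ideal.absNorm v.asIdeal : ℝ) * ν.real {d : ↥(HeisRing.fixedPart (conjLocal L (IsCMField.complexConj L) v)) | Valued.v ((d : LocalRing L v) w) < 1}) :
    Φ ^ 2 * X = (((Ideal.absNorm v.asIdeal : ℝ) : ℂ))⁻¹ *
      ((ν.real {d : ↥(HeisRing.fixedPart (conjLocal L (IsCMField.complexConj L) v)) | Valued.v ((d : LocalRing L v) w) ≤ 1} : ℝ) : ℂ) ^ 2 := by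
  obtain ⟨-, hCtop⟩ := measure_fixedUnits_pos_lt_top L v w hw ν
  have hmtop := (measure_fixedBall_lt_top L v w hw ν).2
  have hO := measureReal_fixedBall_eq_add L v w ν hCtop.ne hmtop.ne
  have hG := gauss_sq_eq L v w hw ν χ₁ h₁ hu hB hfixP hFε hadd hI₁ hI₀
  have hδ := chi_skewUnit_sq L v w hw χ₁ hB piU hpiU δ' hδ'σ hδ'v
  rw [← hX] at hδ
  have hq : (Ideal.absNorm v.asIdeal : ℂ) ≠ 0 := Nat.cast_ne_zero.2 fun h => v.ne_bot (Ideal.absNorm_eq_zero_iff.1 h)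
  have hX0 : X ≠ 0 := by rw [hX]; exact Units.ne_zero _
  have hinv : (((χ₁ δ')⁻¹ : ℂˣ) : ℂ) = (((χ₁ δ' : ℂˣ) : ℂ))⁻¹ := Units.val_inv_eq_inv_val _
  have hqm : (Ideal.absNorm v.asIdeal : ℂ) * ((ν.real {d : ↥(HeisRing.fixedPart (conjLocal L (IsCMField.complexConj L) v)) | Valued.v ((d : LocalRing L v) w) < 1} : ℝ) : ℂ) =
      ((ν.real {c : ↥(HeisRing.fixedPart (conjLocal L (IsCMField.complexConj L) v)) | Valued.v ((c : LocalRing L v) w) = 1} : ℝ) : ℂ) + ((ν.real {d : ↥(HeisRing.fixedPart (conjLocal L (IsCMField.complexConj L) v)) | Valued.v ((d : LocalRing L v) w) < 1} : ℝ) : ℂ) := by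
    have h := congrArg (fun x : ℝ => (x : ℂ)) (hball.symm.trans hO)
    push_cast at h
    exact h
  rw [hΦ, setIntegral_fixedUnits_diteInv_mul_eq_dite_mul L v w hw ν χ₁ h₁ hu, hinv, mul_pow, hG, hO]
  push_cast
  -- pure algebra in the atoms `qC mC cC dC sC X`: `(dC⁻¹)²·(sC·mC·(mC+cC))·X = qC⁻¹·(cC+mC)²` from `dC² = sC·X` and `qC·mC = cC+mC`
  set qC : ℂ := (Ideal.absNorm v.asIdeal : ℂ)
  set mC : ℂ := ((ν.real {d : ↥(HeisRing.fixedPart (conjLocal L (IsCMField.complexConj L) v)) | Valued.v ((d : LocalRing L v) w) < 1} : ℝ) : ℂ)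
  set cC : ℂ := ((ν.real {c : ↥(HeisRing.fixedPart (conjLocal L (IsCMField.complexConj L) v)) | Valued.v ((c : LocalRing L v) w) = 1} : ℝ) : ℂ)
  set dC : ℂ := ((χ₁ δ' : ℂˣ) : ℂ)
  set sC : ℂ := ((χ₁ (-1) : ℂˣ) : ℂ)
  have hsX : sC * X ≠ 0 := mul_ne_zero (Units.ne_zero _) hX0
  have key : (dC⁻¹) ^ 2 * (sC * mC * (mC + cC)) * X = mC * (mC + cC) := by
    rw [inv_pow, hδ]
    calc (sC * X)⁻¹ * (sC * mC * (mC + cC)) * X = (sC * X)⁻¹ * (sC * X) * (mC * (mC + cC)) := by ring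
      _ = mC * (mC + cC) := by rw [inv_mul_cancel₀ hsX, one_mul]
  rw [key, eq_inv_mul_iff_mul_eq₀ hq]
  calc qC * (mC * (mC + cC)) = (qC * mC) * (mC + cC) := by ring
    _ = (cC + mC) ^ 2 := by rw [hqm]; ring
end Haar

end Summit.HodgeConjecture.HodgeConjecture.R90.S1.BposRamGaussSquareModLetters
end
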